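import Mathlib
import HarnessLib

/-!
# Item `LrcModEntire` (stmt-NavierStokesRegularity-20428), skeleton twist_split v6 — T1 cell, step (I), lemma (P):
# the POINCARÉ LEMMA for `C¹` curl-free vector fields on a finite-dimensional inner product space (explicit line-integral potential)

Cell ns-regularity-ideate, seat ns-k2-port-2 g4 (free hand; `--supports stmt-NavierStokesRegularity-20428 --as helper`; ask of the LEAD ns-poloidal-K2-p3 g13,
STATUS 2026-08-29T04:55:55Z / crux memo CELLS-TH-g13 §2ter (S): «curlₕ a⁽ʲ⁾ = 0 … Poincaré on ℝ² (explicit line-integral potential φ_j, C^∞) ⇒ a⁽ʲ⁾ = ∇φ_j»).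

Setting: `E` a finite-dimensional real inner product space (ℝ² = `EuclideanSpace ℝ (Fin 2)` is the LEAD's case), `a : E → E` of class `C¹` with SYMMETRIC
Jacobian `⟪Da(x)u, w⟫ = ⟪Da(x)w, u⟫` (in the plane: `∂₀a₁ = ∂₁a₀`, i.e. `curl a = 0`).  The potential is the explicit line integral along rays,
`φ(x) := ∫₀¹ ⟪a(t·x), x⟫ dt`.

* `hasFDerivAt_rayPotential` — `Dφ(x) = ⟪a(x), ·⟫`, i.e. `∇φ = a` (differentiation under the integral sign + the identity
  `⟪Da(tx)(th), x⟫ + ⟪a(tx), h⟫ = d/dt ⟪t·a(tx), h⟫` from the symmetry, + FTC);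
* `contDiff_rayPotential` — `a ∈ Cⁿ` (`n ≥ 1`) ⇒ `φ ∈ Cⁿ⁺¹` (from the gradient identity: `Dφ = innerSL ∘ a` and `innerSL` is linear);
* `exists_potential_of_symmetric_fderiv` — packaged: `∃ φ`, `ContDiff ℝ (n+1) φ ∧ ∀ x h, Dφ(x)h = ⟪a(x), h⟫`.

WHAT THIS IS NOT: not a claim about Navier–Stokes regularity — generic calculus for the T1 cell of the (TH) column (bears_on LADDER-NS N0, item 20428 / crux 19708;
both OPEN).
-/

noncomputable section

-- the summit and its single sub-problem share the name (CONVENTIONS §1), as in every Theorems file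
set_option linter.dupNamespace false

namespace Summit.NavierStokesRegularity.NavierStokesRegularity.Theorems.PoloidalWindowDoorLrcModEntireTwistingTHPoincareLemma

open Set Function Filter Topology MeasureTheory InnerProductSpace intervalIntegral
open scoped RealInnerProductSpace InnerProductSpace Interval

section Space

variable {E : Type*} [NormedAddCommGroup E] [InnerProductSpace ℝ E] [FiniteDimensional ℝ E]

/-! ### Pointwise derivative of the integrand -/

omit [FiniteDimensional ℝ E] in
/-- For fixed `t`, `x ↦ ⟪a(t·x), x⟫` has derivative `h ↦ t⟪Da(tx)h, x⟫ + ⟪a(tx), h⟫`. -/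
theorem hasFDerivAt_integrand {a : E → E} (ha : Differentiable ℝ a) (t : ℝ) (x : E) :
    HasFDerivAt (fun y : E => ⟪a (t • y), y⟫_ℝ)
      (t • ((innerSL ℝ x).comp (fderiv ℝ a (t • x))) + innerSL ℝ (a (t • x))) x := by
  have hG : HasFDerivAt (fun y : E => a (t • y)) ((fderiv ℝ a (t • x)).comp (t • ContinuousLinearMap.id ℝ E)) x :=
    (ha (t • x)).hasFDerivAt.comp x ((hasFDerivAt_id x).const_smul t)
  have h := hG.inner ℝ (hasFDerivAt_id x)
  refine h.congr_fderiv ?_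
  ext h'
  simp only [add_apply, smul_apply, ContinuousLinearMap.comp_apply, innerSL_apply_apply, fderivInnerCLM_apply, ContinuousLinearMap.prod_apply,
    ContinuousLinearMap.id_apply, id, map_smul, smul_eq_mul, real_inner_smul_right, real_inner_comm x]
  all_goals ring

omit [FiniteDimensional ℝ E] in
/-- The `t`-derivative behind the FTC step: `d/dt ⟪t·a(tx), h⟫ = ⟪a(tx), h⟫ + t⟪Da(tx)x, h⟫`. -/
theorem hasDerivAt_ray {a : E → E} (ha : Differentiable ℝ a) (x h : E) (t : ℝ) :
    HasDerivAt (fun s : ℝ => ⟪s • a (s • x), h⟫_ℝ) (⟪a (t • x), h⟫_ℝ + t * ⟪fderiv ℝ a (t • x) x, h⟫_ℝ) t := by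
  have h1 : HasDerivAt (fun s : ℝ => s • x) x t := by simpa using (hasDerivAt_id t).smul_const x
  have h2 : HasDerivAt (fun s : ℝ => a (s • x)) (fderiv ℝ a (t • x) x) t := (ha (t • x)).hasFDerivAt.comp_hasDerivAt t h1
  have h3 : HasDerivAt (fun s : ℝ => s • a (s • x)) (t • fderiv ℝ a (t • x) x + (1:ℝ) • a (t • x)) t := (hasDerivAt_id' t).fun_smul h2
  have h4 := h3.inner ℝ (hasDerivAt_const t h)
  refine h4.congr_deriv ?_
  simp only [inner_zero_right, zero_add, inner_add_left, inner_smul_left, one_smul, RCLike.conj_to_real]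
  all_goals ring

/-! ### The ray potential and its gradient -/

/-- **`∇φ = a` for the ray potential `φ(x) = ∫₀¹ ⟪a(t·x), x⟫ dt`** of a `C¹` field with symmetric Jacobian. -/
theorem hasFDerivAt_rayPotential {a : E → E} (ha : ContDiff ℝ 1 a)
    (hsymm : ∀ x u w : E, ⟪fderiv ℝ a x u, w⟫_ℝ = ⟪fderiv ℝ a x w, u⟫_ℝ) (x : E) :
    HasFDerivAt (fun y : E => ∫ t in (0:ℝ)..1, ⟪a (t • y), y⟫_ℝ) (innerSL ℝ (a x)) x := by
  have had : Differentiable ℝ a := ha.differentiable (by norm_num)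
  have hac : Continuous a := had.continuous
  have hDc : Continuous (fderiv ℝ a) := ha.continuous_fderiv (by norm_num)
  -- the derivative family
  set F' : E → ℝ → E →L[ℝ] ℝ := fun y t => t • ((innerSL ℝ y).comp (fderiv ℝ a (t • y))) + innerSL ℝ (a (t • y)) with hF'
  -- continuity in `t` (for fixed `y`) of the integrand and of `F'`
  have hFc : ∀ y : E, Continuous fun t : ℝ => ⟪a (t • y), y⟫_ℝ := fun y =>
    (hac.comp (continuous_id.smul continuous_const)).inner continuous_const
  have hF'c : ∀ y : E, Continuous fun t : ℝ => F' y t := by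
    intro y
    have h1 : Continuous fun t : ℝ => fderiv ℝ a (t • y) := hDc.comp (continuous_id.smul continuous_const)
    have h2 : Continuous fun t : ℝ => (innerSL ℝ y).comp (fderiv ℝ a (t • y)) := continuous_const.clm_comp h1
    have h3 : Continuous fun t : ℝ => innerSL ℝ (a (t • y)) := (innerSL ℝ).continuous.comp (hac.comp (continuous_id.smul continuous_const))
    simp only [hF']
    exact (continuous_id.smul h2).add h3
  -- a uniform bound on `‖F' y t‖` for `y` near `x`, `t ∈ [0,1]`, from compactness
  obtain ⟨B₀, hB₀⟩ := (isCompact_closedBall (0 : E) (‖x‖ + 1)).exists_bound_of_continuousOn hac.continuousOn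
  obtain ⟨B₁, hB₁⟩ := (isCompact_closedBall (0 : E) (‖x‖ + 1)).exists_bound_of_continuousOn hDc.continuousOn
  have hB₁0 : 0 ≤ B₁ := (norm_nonneg _).trans (hB₁ 0 (Metric.mem_closedBall_self (by positivity)))
  have hball : ∀ y ∈ Metric.ball x 1, ∀ t ∈ Ι (0:ℝ) 1, t • y ∈ Metric.closedBall (0 : E) (‖x‖ + 1) ∧ ‖y‖ ≤ ‖x‖ + 1 := by
    intro y hy t ht
    rw [Set.uIoc_of_le zero_le_one, Set.mem_Ioc] at ht
    have hy' : ‖y‖ ≤ ‖x‖ + 1 := by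
      have h := norm_sub_norm_le y x
      rw [Metric.mem_ball, dist_eq_norm] at hy
      linarith
    refine ⟨?_, hy'⟩
    rw [Metric.mem_closedBall, dist_zero_right, norm_smul, Real.norm_eq_abs, abs_of_pos ht.1]
    nlinarith [norm_nonneg y, ht.2]
  have hkey := intervalIntegral.hasFDerivAt_integral_of_dominated_of_fderiv_le (μ := volume) (a := 0) (b := 1)
    (F := fun y t => ⟪a (t • y), y⟫_ℝ) (F' := F') (x₀ := x) (s := Metric.ball x 1) (bound := fun _ => (‖x‖ + 1) * B₁ + B₀)
    (Metric.ball_mem_nhds x one_pos)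
    (Eventually.of_forall fun y => (hFc y).aestronglyMeasurable)
    ((hFc x).intervalIntegrable 0 1)
    ((hF'c x).aestronglyMeasurable)
    (Eventually.of_forall fun t ht y hy => by
      obtain ⟨hty, hy'⟩ := hball y hy t ht
      rw [Set.uIoc_of_le zero_le_one, Set.mem_Ioc] at ht
      simp only [hF']
      calc ‖t • ((innerSL ℝ y).comp (fderiv ℝ a (t • y))) + innerSL ℝ (a (t • y))‖
          ≤ ‖t • ((innerSL ℝ y).comp (fderiv ℝ a (t • y)))‖ + ‖innerSL ℝ (a (t • y))‖ := norm_add_le _ _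
        _ ≤ |t| * (‖innerSL ℝ y‖ * ‖fderiv ℝ a (t • y)‖) + ‖a (t • y)‖ := by
            rw [norm_smul, Real.norm_eq_abs, innerSL_apply_norm]
            exact add_le_add (mul_le_mul_of_nonneg_left (ContinuousLinearMap.opNorm_comp_le _ _) (abs_nonneg t)) le_rfl
        _ ≤ 1 * ((‖x‖ + 1) * B₁) + B₀ := by
            rw [innerSL_apply_norm]
            refine add_le_add (mul_le_mul (by rw [abs_of_pos ht.1]; exact ht.2)
              (mul_le_mul hy' (hB₁ _ hty) (norm_nonneg _) (by positivity)) (by positivity) zero_le_one) (hB₀ _ hty)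
        _ = (‖x‖ + 1) * B₁ + B₀ := by ring)
    intervalIntegrable_const
    (Eventually.of_forall fun t _ y _ => hasFDerivAt_integrand had t y)
  -- identify the derivative: `(∫ F' x t dt) h = ∫₀¹ d/dt ⟪t a(tx), h⟫ dt = ⟪a x, h⟫`
  have hint : IntervalIntegrable (F' x) volume 0 1 := (hF'c x).intervalIntegrable 0 1
  have hval : (∫ t in (0:ℝ)..1, F' x t) = innerSL ℝ (a x) := by
    ext h
    rw [ContinuousLinearMap.intervalIntegral_apply hint h]
    have e1 : (fun t : ℝ => F' x t h) = fun t => ⟪a (t • x), h⟫_ℝ + t * ⟪fderiv ℝ a (t • x) x, h⟫_ℝ := by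
      funext t
      simp only [hF', add_apply, smul_apply, ContinuousLinearMap.comp_apply, innerSL_apply_apply, smul_eq_mul]
      rw [real_inner_comm (fderiv ℝ a (t • x) h) x, hsymm (t • x) h x]
      ring
    rw [e1]
    have hderiv := fun t => hasDerivAt_ray had x h t
    have hcont : Continuous fun t : ℝ => ⟪a (t • x), h⟫_ℝ + t * ⟪fderiv ℝ a (t • x) x, h⟫_ℝ := by
      have h1 : Continuous fun t : ℝ => fderiv ℝ a (t • x) x := (hDc.comp (continuous_id.smul continuous_const)).clm_apply continuous_const
      exact ((hac.comp (continuous_id.smul continuous_const)).inner continuous_const).add (continuous_id.mul (h1.inner continuous_const))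
    rw [intervalIntegral.integral_eq_sub_of_hasDerivAt (fun t _ => hderiv t) (hcont.intervalIntegrable 0 1)]
    simp
  rw [hval] at hkey
  exact hkey

/-- **The ray potential is `C^{n+1}` if the field is `Cⁿ`** (`n ≥ 1`), because its derivative is `innerSL ∘ a`. -/
theorem contDiff_rayPotential {a : E → E} {n : ℕ} (hn : 1 ≤ n) (ha : ContDiff ℝ n a)
    (hsymm : ∀ x u w : E, ⟪fderiv ℝ a x u, w⟫_ℝ = ⟪fderiv ℝ a x w, u⟫_ℝ) :
    ContDiff ℝ (n + 1) (fun y : E => ∫ t in (0:ℝ)..1, ⟪a (t • y), y⟫_ℝ) := by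
  have ha1 : ContDiff ℝ 1 a := ha.of_le (by exact_mod_cast hn)
  have hD : ∀ x, HasFDerivAt (fun y : E => ∫ t in (0:ℝ)..1, ⟪a (t • y), y⟫_ℝ) (innerSL ℝ (a x)) x :=
    hasFDerivAt_rayPotential ha1 hsymm
  have hfd : fderiv ℝ (fun y : E => ∫ t in (0:ℝ)..1, ⟪a (t • y), y⟫_ℝ) = fun x => innerSL ℝ (a x) := funext fun x => (hD x).fderiv
  rw [show ((n : WithTop ℕ∞) + 1) = ((n : ℕ∞) : WithTop ℕ∞) + 1 by norm_cast, contDiff_succ_iff_fderiv]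
  refine ⟨fun x => (hD x).differentiableAt, by simp, ?_⟩
  rw [hfd]
  exact (innerSL ℝ).contDiff.comp (by exact_mod_cast ha)

/-- **THE POINCARÉ LEMMA** (gradient version): a `Cⁿ` (`n ≥ 1`) vector field on a finite-dimensional inner product space with symmetric Jacobian
(`curl a = 0`) is the gradient of a `C^{n+1}` potential: `∃ φ ∈ C^{n+1}`, `Dφ(x)h = ⟪a(x), h⟫` for all `x, h`. -/
theorem exists_potential_of_symmetric_fderiv {a : E → E} {n : ℕ} (hn : 1 ≤ n) (ha : ContDiff ℝ n a)
    (hsymm : ∀ x u w : E, ⟪fderiv ℝ a x u, w⟫_ℝ = ⟪fderiv ℝ a x w, u⟫_ℝ) :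
    ∃ φ : E → ℝ, ContDiff ℝ (n + 1) φ ∧ ∀ x h : E, fderiv ℝ φ x h = ⟪a x, h⟫_ℝ := by
  refine ⟨fun y => ∫ t in (0:ℝ)..1, ⟪a (t • y), y⟫_ℝ, contDiff_rayPotential hn ha hsymm, fun x h => ?_⟩
  rw [(hasFDerivAt_rayPotential (ha.of_le (by exact_mod_cast hn)) hsymm x).fderiv, innerSL_apply_apply]

end Space

/-! ### The planar case in coordinates (`curl a = ∂₀a₁ − ∂₁a₀ = 0`) -/

section Plane

/-- In the plane, `∂₀a₁ = ∂₁a₀` at `x` is the symmetry of the Jacobian `Da(x)`. -/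
theorem symm_of_planar_curlFree {a : EuclideanSpace ℝ (Fin 2) → EuclideanSpace ℝ (Fin 2)} {x : EuclideanSpace ℝ (Fin 2)}
    (hcurl : fderiv ℝ a x (EuclideanSpace.single 0 1) 1 = fderiv ℝ a x (EuclideanSpace.single 1 1) 0) (u w : EuclideanSpace ℝ (Fin 2)) :
    ⟪fderiv ℝ a x u, w⟫_ℝ = ⟪fderiv ℝ a x w, u⟫_ℝ := by
  have hexp : ∀ v : EuclideanSpace ℝ (Fin 2), v = v 0 • EuclideanSpace.single 0 (1:ℝ) + v 1 • EuclideanSpace.single 1 (1:ℝ) := by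
    intro v
    ext i
    fin_cases i <;> simp
  rw [hexp u, hexp w]
  simp only [map_add, map_smul, inner_add_left, inner_add_right, real_inner_smul_right,
    EuclideanSpace.inner_single_right, conj_trivial]
  simp only [PiLp.smul_apply, smul_eq_mul]
  rw [hcurl]
  ring

/-- **Planar Poincaré lemma in coordinates**: a `Cⁿ` (`n ≥ 1`) planar field with `∂₀a₁ = ∂₁a₀` everywhere is `∇φ` for a `Cⁿ⁺¹` potential `φ`
(`∂ᵢφ = aᵢ`), namely the ray potential `φ(x) = ∫₀¹ ⟪a(tx), x⟫ dt`. -/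
theorem exists_potential_of_planar_curlFree {a : EuclideanSpace ℝ (Fin 2) → EuclideanSpace ℝ (Fin 2)} {n : ℕ} (hn : 1 ≤ n) (ha : ContDiff ℝ n a)
    (hcurl : ∀ x : EuclideanSpace ℝ (Fin 2), fderiv ℝ a x (EuclideanSpace.single 0 1) 1 = fderiv ℝ a x (EuclideanSpace.single 1 1) 0) :
    ∃ φ : EuclideanSpace ℝ (Fin 2) → ℝ, ContDiff ℝ (n + 1) φ ∧ (∀ x h : EuclideanSpace ℝ (Fin 2), fderiv ℝ φ x h = ⟪a x, h⟫_ℝ) ∧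
      ∀ (x : EuclideanSpace ℝ (Fin 2)) (i : Fin 2), fderiv ℝ φ x (EuclideanSpace.single i 1) = a x i := by
  have hsymm : ∀ x u w : EuclideanSpace ℝ (Fin 2), ⟪fderiv ℝ a x u, w⟫_ℝ = ⟪fderiv ℝ a x w, u⟫_ℝ := fun x u w =>
    symm_of_planar_curlFree (hcurl x) u w
  obtain ⟨φ, hφ, hD⟩ := exists_potential_of_symmetric_fderiv hn ha hsymm
  refine ⟨φ, hφ, hD, fun x i => ?_⟩
  rw [hD, EuclideanSpace.inner_single_right]
  simp

end Plane

end Summit.NavierStokesRegularity.NavierStokesRegularity.Theorems.PoloidalWindowDoorLrcModEntireTwistingTHPoincareLemma
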